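import Summits.BirchSwinnertonDyer.BirchSwinnertonDyer.Theorems.ByReductionTypeAtTwoAdditivePotGoodPrintZhaiIrreducibleUnramified
import Summits.BirchSwinnertonDyer.Rank1Residual.P2.KrizLiSmallCMBaseTransport
import HarnessLib

/-!
# K4 crux `AdditiveRankZeroAtTwo` (19098), children C3″ `AdditivePotGoodLowerHalfAtTwo` (22617) and C1″ (22615): the
# KRIZ–LI 2019 PRINT ROAD — `BSD(·, 2)` (BOTH K4 halves) on the quadratic-twist family `{V^{(d)}, V^{(d·d_K)} : d ∈ 𝒩, χ_d(−N) = 1}`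
# of a NON-CM base `V` of conductor `< 5000` with `V(ℚ)[2] = 0`, granted the (★)-datum — base-generic, field-generic

Cell `bsd-2adic`, seat `bsd-2adic-k4-w2` GEN 7 (prover, explicit unit, no kit); `--supports stmt-BirchSwinnertonDyer-22617 --as helper`.
HONEST FRAMING (D-0036/D-0054): a third printed mechanism for the additive potentially-good block, after Zhai 2016 (GEN 6, LOWER half
on `E[2]`-irreducible families) and Shu–Zhai 2021 (GEN 6, both halves on `E[2]`-REDUCIBLE families): Kriz–Li 2019 Thm 5.1 (2)
(= arXiv Thm 1.12; tree fact `KrizLi2019.thm112_bsdTwo_twist`) TRANSPORTS Miller's `BSD(E, 2)` from the pair `(E, E^{(d_K)})` to every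
twist `E^{(d)}`, `E^{(d·d_K)}` with `d ∈ 𝒩(E, K)` (square-free, `≡ 1 (mod 4)`, prime factors `ℓ ∤ 2N` split in `K` with `a_ℓ(E)` odd)
and `χ_d(−N) = 1`, for a base with `E(ℚ)[2] = 0` (so `E[2]` IRREDUCIBLE), a Heegner field `K` with `2` split and a Heegner point
with Assumption (★); Thm 4.3 (`KrizLi2019.thm33_rank_twist`) gives the analytic ranks `{0, 1}` of the pair. The cell `bsd-print-cf2`
closed this door for CM bases (`P2.bsdp_two_of_twist_of_krizLi_cmBase`, partner by Burungale–Flach). THIS FILE is the NON-CM version the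
K4 additive block needs: BOTH bases `E` and `E^{(d_K)}` are taken from Creutz–Miller 2012 / Miller 2011 (`bsdTriple_of_analyticRank_le_one_of_conductor_lt`,
`r_an ≤ 1` from Thm 4.3 at `d = 1`, conductor `< 5000` — an INPUT per base, kernel at the instances), so NO rank input is needed for
`BSD(·, 2)` on the whole family (§3). The K4-keyed sorting (§4: which member is the rank-`0` one — C3″/C1″ at `2` — and which the
rank-`1` companion — K4's `RankOneAtTwo` children) displays the base's `r_an(V) = 0` (Cremona's Table 1 column / the caption «rank
zero curves» of Kriz–Li's Table 2). The habitat (`Addv`, `0 ≤ ord₂ j`, `¬CM`, `Irr`) travels along the UNRAMIFIED twists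
`d, d·d_K ≡ 1 (mod 4)` by GEN 6's `habitat_twist_of_addv`. Instances (files `…PrintKrizLi44a1.lean`, `…PrintKrizLi92a1.lean`): the two
rows `44a1 | −7 | 3 | ✓`, `92a1 | −7 | 3 | ✓` of Kriz–Li's Table 2 — the only additive-at-`2` rows with `49·N < 5000`. Closes nothing at
the `∀`-level (C3″/C1″ research-open); nothing booked; BSD is not proved by any of this.

CONTENTS (0 `def`, 0 `sorry`; inputs BY NAME: `hKL` Thm 5.1 (2), `h33` Thm 4.3, `hS31` Creutz–Miller, `hGZK` Gross–Zagier–Kolyvagin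
(finiteness of `Ш` for the halves bookkeeping only)).
* §1 `krizLi_analyticRank_twists` (Thm 4.3 at `d`, tree orientation), `krizLi_analyticRank_le_one` / `…_partner_le_one` (at `d = 1`).
* §2 `krizLi_bsdp_two_base_of_conductor_lt`, `krizLi_bsdp_two_partner_of_conductor_lt` (Creutz–Miller on the pair).
* §3 `krizLi_bsdp_two_of_twist_of_conductor_lt` — `BSD(W', 2)` at every global minimal `W' ≅ V^{(d)}` or `V^{(d·d_K)}`; no rank input.
* §4 `printFamilyKrizLi_rankZero` (`r_an = 0 ∧ Addv ∧ 0 ≤ ord₂ j ∧ ¬CM ∧ Irr ∧ BSDp ∧ MissingLower ∧ MissingUpper` at `V^{(d)}`),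
  `printFamilyKrizLi_rankOne` (`r_an = 1 ∧ habitat ∧ BSDp` at `V^{(d·d_K)}`), from the displayed `r_an(V) = 0` and the kernel habitat of `V`.

References: [KrizLi2019] Thm 5.1 (2) (FMS VoR p. 30) = arXiv:1606.03172 Thm 1.12, Thm 4.3, Def 4.1, Rem 5.2, §6 Ex. 6.4–6.5, Table 2;
[CreutzMiller2012] Thm 1.1; [Miller2011LMS] Def 1.1, Thm 1.2; [SilvermanAEC2009] VII.5, X.5; tree `P2/TransportAtTwo.lean`,
`P2/KrizLiSmallCMBaseTransport.lean`, GEN 6 `…PrintZhaiIrreducibleUnramified.lean`.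
-/

set_option autoImplicit false
-- the Theorems namespace of this sub repeats the summit name by design (D-0017 nested layout)
set_option linter.dupNamespace false

noncomputable section

open scoped Classical

open WeierstrassCurve NumberField Literature.NumberTheory.EllipticCurves
  Literature.NumberTheory.EllipticCurves.ModularForms
  Literature.NumberTheory.EllipticCurves.Rank1Residual
  Literature.NumberTheory.EllipticCurves.Rank1Residual.Typed
  Summit.BirchSwinnertonDyer.Rank1Residual
  Summit.BirchSwinnertonDyer.Rank1Residual.P2

namespace Summit.BirchSwinnertonDyer.BirchSwinnertonDyer.Theorems.AddPotGoodPrint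

section Base

variable (V : WeierstrassCurve ℚ) [V.IsElliptic] [V.IsGloballyMinimal] [NeZero (V.conductorNorm ℤ)]

/-! ## §1 Analytic ranks along the family (Kriz–Li Thm 4.3) -/

/-- **Kriz–Li Thm 4.3 at `d ∈ 𝒩` with `χ_d(−N) = 1`, tree orientation**: at global minimal models `W₁ ≅ V^{(d)}`, `W₂ ≅ V^{(d·d_K)}`:
`{r_an(W₁), r_an(W₂)} = {0, 1}` and `r_an(W₁) = r_an(V)`. [cite: KrizLi2019, Thm. 4.3 (FMS) = arXiv:1606.03172 Thm. 3.3] -/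
theorem krizLi_analyticRank_twists (h33 : KrizLi2019.thm33_rank_twist) (h2 : ∀ Q : V.toAffine.Point, 2 • Q = 0 → Q = 0)
    (K : Type) [Field K] [NumberField K] (hK : IsImaginaryQuadratic K) (hH : SatisfiesHeegnerHypothesis (V.conductorNorm ℤ) K)
    (Dt : ModularParametrizationData V (V.conductorNorm ℤ)) (H : HeegnerDatum (V.conductorNorm ℤ) (NumberField.discr K))
    (ι : K →+* ℂ) (P : (V.baseChange K).toAffine.Point) (hP : WeierstrassCurve.Affine.Point.map ι.toRatAlgHom P = heegnerPointComplex Dt H)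
    (j : K →ₐ[ℚ] ℚ_[2]) (hstar : KrizLi2019.AssumptionStar V Dt K P j)
    {d : ℤ} (hd : KrizLi2019.InN V K d) (hsign : Int.sign d * jacobiSym (V.conductorNorm ℤ) d.natAbs = 1)
    (W₁ W₂ : WeierstrassCurve ℚ) [W₁.IsElliptic] [W₁.IsGloballyMinimal] [W₂.IsElliptic] [W₂.IsGloballyMinimal]
    (hW₁ : ∃ C : VariableChange ℚ, C • V.quadraticTwist (d : ℚ) = W₁)
    (hW₂ : ∃ C : VariableChange ℚ, C • V.quadraticTwist ((d * NumberField.discr K : ℤ) : ℚ) = W₂) :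
    ((W₁.analyticRank = 1 ∧ W₂.analyticRank = 0) ∨ (W₁.analyticRank = 0 ∧ W₂.analyticRank = 1)) ∧
      W₁.analyticRank = V.analyticRank := by
  obtain ⟨-, -, hor, hiff⟩ := h33 V h2 K hK hH Dt H ι P hP j hstar d hd W₁ W₂ (exists_smul_eq_comm.2 hW₁) (exists_smul_eq_comm.2 hW₂)
  exact ⟨hor, hiff.2 hsign⟩

/-- **`r_an(V) ≤ 1`** from Thm 4.3 at `d = 1` (the empty product is in `𝒩`; `χ_1 = 1`).
[cite: KrizLi2019, Thm. 4.3 (FMS) = arXiv:1606.03172 Thm. 3.3] -/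
theorem krizLi_analyticRank_le_one (h33 : KrizLi2019.thm33_rank_twist) (h2 : ∀ Q : V.toAffine.Point, 2 • Q = 0 → Q = 0)
    (K : Type) [Field K] [NumberField K] (hK : IsImaginaryQuadratic K) (hH : SatisfiesHeegnerHypothesis (V.conductorNorm ℤ) K)
    (Dt : ModularParametrizationData V (V.conductorNorm ℤ)) (H : HeegnerDatum (V.conductorNorm ℤ) (NumberField.discr K))
    (ι : K →+* ℂ) (P : (V.baseChange K).toAffine.Point) (hP : WeierstrassCurve.Affine.Point.map ι.toRatAlgHom P = heegnerPointComplex Dt H)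
    (j : K →ₐ[ℚ] ℚ_[2]) (hstar : KrizLi2019.AssumptionStar V Dt K P j) : V.analyticRank ≤ 1 := by
  obtain ⟨W₁, _, _, hW₁⟩ := exists_globallyMinimal_twist V (d := (1 : ℚ)) one_ne_zero
  have hD : (NumberField.discr K : ℚ) ≠ 0 := by exact_mod_cast NumberField.discr_ne_zero K
  obtain ⟨W₀, _, _, hW₀⟩ := exists_globallyMinimal_twist V hD
  obtain ⟨hor, heq⟩ := analyticRank_dichotomy_of_assumptionStar V h33 h2 K hK hH Dt H ι P hP j hstar W₁ W₀ hW₁ hW₀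
  omega

/-- **`r_an(W₀) ≤ 1`** at every global minimal `W₀ ≅ V^{(d_K)}` (Thm 4.3 at `d = 1`).
[cite: KrizLi2019, Thm. 4.3 (FMS) = arXiv:1606.03172 Thm. 3.3] -/
theorem krizLi_analyticRank_partner_le_one (h33 : KrizLi2019.thm33_rank_twist) (h2 : ∀ Q : V.toAffine.Point, 2 • Q = 0 → Q = 0)
    (K : Type) [Field K] [NumberField K] (hK : IsImaginaryQuadratic K) (hH : SatisfiesHeegnerHypothesis (V.conductorNorm ℤ) K)
    (Dt : ModularParametrizationData V (V.conductorNorm ℤ)) (H : HeegnerDatum (V.conductorNorm ℤ) (NumberField.discr K))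
    (ι : K →+* ℂ) (P : (V.baseChange K).toAffine.Point) (hP : WeierstrassCurve.Affine.Point.map ι.toRatAlgHom P = heegnerPointComplex Dt H)
    (j : K →ₐ[ℚ] ℚ_[2]) (hstar : KrizLi2019.AssumptionStar V Dt K P j)
    (W₀ : WeierstrassCurve ℚ) [W₀.IsElliptic] [W₀.IsGloballyMinimal]
    (hW₀ : ∃ C : VariableChange ℚ, C • V.quadraticTwist (NumberField.discr K : ℚ) = W₀) : W₀.analyticRank ≤ 1 := by
  obtain ⟨W₁, _, _, hW₁⟩ := exists_globallyMinimal_twist V (d := (1 : ℚ)) one_ne_zero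
  obtain ⟨hor, -⟩ := analyticRank_dichotomy_of_assumptionStar V h33 h2 K hK hH Dt H ι P hP j hstar W₁ W₀ hW₁ hW₀
  omega

/-- **The partner has analytic rank `1` when the base has analytic rank `0`** (Thm 4.3 at `d = 1`).
[cite: KrizLi2019, Thm. 4.3 (FMS) and §6 Example 6.4] -/
theorem krizLi_analyticRank_partner_eq_one_of_rankZero (h33 : KrizLi2019.thm33_rank_twist)
    (h2 : ∀ Q : V.toAffine.Point, 2 • Q = 0 → Q = 0)
    (K : Type) [Field K] [NumberField K] (hK : IsImaginaryQuadratic K) (hH : SatisfiesHeegnerHypothesis (V.conductorNorm ℤ) K)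
    (Dt : ModularParametrizationData V (V.conductorNorm ℤ)) (H : HeegnerDatum (V.conductorNorm ℤ) (NumberField.discr K))
    (ι : K →+* ℂ) (P : (V.baseChange K).toAffine.Point) (hP : WeierstrassCurve.Affine.Point.map ι.toRatAlgHom P = heegnerPointComplex Dt H)
    (j : K →ₐ[ℚ] ℚ_[2]) (hstar : KrizLi2019.AssumptionStar V Dt K P j) (hr : V.analyticRank = 0)
    (W₀ : WeierstrassCurve ℚ) [W₀.IsElliptic] [W₀.IsGloballyMinimal]
    (hW₀ : ∃ C : VariableChange ℚ, C • V.quadraticTwist (NumberField.discr K : ℚ) = W₀) : W₀.analyticRank = 1 := by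
  obtain ⟨W₁, _, _, hW₁⟩ := exists_globallyMinimal_twist V (d := (1 : ℚ)) one_ne_zero
  obtain ⟨hor, heq⟩ := analyticRank_dichotomy_of_assumptionStar V h33 h2 K hK hH Dt H ι P hP j hstar W₁ W₀ hW₁ hW₀
  omega

/-! ## §2 The base pair from Creutz–Miller (conductor `< 5000`, analytic rank `≤ 1` by §1) -/

/-- **`BSD(V, 2)` for the base** — Creutz–Miller 2012 / Miller 2011 (`hS31`) on `r_an(V) ≤ 1` (Thm 4.3) and `N(V) < 5000` — where
Kriz–Li say «by numerical verification» (Rem. 5.2, Example 6.4). [cite: CreutzMiller2012, Thm. 1.1] [cite: KrizLi2019, Rem. 5.2 and Example 6.4] -/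
theorem krizLi_bsdp_two_base_of_conductor_lt (h33 : KrizLi2019.thm33_rank_twist)
    (hS31 : bsdTriple_of_analyticRank_le_one_of_conductor_lt) (hN : V.conductorNorm ℤ < 5000)
    (h2 : ∀ Q : V.toAffine.Point, 2 • Q = 0 → Q = 0)
    (K : Type) [Field K] [NumberField K] (hK : IsImaginaryQuadratic K) (hH : SatisfiesHeegnerHypothesis (V.conductorNorm ℤ) K)
    (Dt : ModularParametrizationData V (V.conductorNorm ℤ)) (H : HeegnerDatum (V.conductorNorm ℤ) (NumberField.discr K))
    (ι : K →+* ℂ) (P : (V.baseChange K).toAffine.Point) (hP : WeierstrassCurve.Affine.Point.map ι.toRatAlgHom P = heegnerPointComplex Dt H)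
    (j : K →ₐ[ℚ] ℚ_[2]) (hstar : KrizLi2019.AssumptionStar V Dt K P j) : BSDp V 2 :=
  bsdp_two_of_analyticRank_le_one_of_conductor_lt_5000 hS31 V
    (krizLi_analyticRank_le_one V h33 h2 K hK hH Dt H ι P hP j hstar) hN

/-- **`BSD(W₀, 2)` for the partner `W₀ ≅ V^{(d_K)}`** — Creutz–Miller on `r_an(W₀) ≤ 1` (Thm 4.3) and `N(W₀) < 5000` (an input:
`N(V^{(d_K)}) = d_K²·N(V)` at the instances). [cite: CreutzMiller2012, Thm. 1.1] [cite: KrizLi2019, Rem. 5.2 and Example 6.4] -/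
theorem krizLi_bsdp_two_partner_of_conductor_lt (h33 : KrizLi2019.thm33_rank_twist)
    (hS31 : bsdTriple_of_analyticRank_le_one_of_conductor_lt) (h2 : ∀ Q : V.toAffine.Point, 2 • Q = 0 → Q = 0)
    (K : Type) [Field K] [NumberField K] (hK : IsImaginaryQuadratic K) (hH : SatisfiesHeegnerHypothesis (V.conductorNorm ℤ) K)
    (Dt : ModularParametrizationData V (V.conductorNorm ℤ)) (H : HeegnerDatum (V.conductorNorm ℤ) (NumberField.discr K))
    (ι : K →+* ℂ) (P : (V.baseChange K).toAffine.Point) (hP : WeierstrassCurve.Affine.Point.map ι.toRatAlgHom P = heegnerPointComplex Dt H)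
    (j : K →ₐ[ℚ] ℚ_[2]) (hstar : KrizLi2019.AssumptionStar V Dt K P j)
    (W₀ : WeierstrassCurve ℚ) [W₀.IsElliptic] [W₀.IsGloballyMinimal]
    (hW₀ : ∃ C : VariableChange ℚ, C • V.quadraticTwist (NumberField.discr K : ℚ) = W₀) (hN₀ : W₀.conductorNorm ℤ < 5000) :
    BSDp W₀ 2 :=
  bsdp_two_of_analyticRank_le_one_of_conductor_lt_5000 hS31 W₀
    (krizLi_analyticRank_partner_le_one V h33 h2 K hK hH Dt H ι P hP j hstar W₀ hW₀) hN₀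

/-! ## §3 THE ROAD: `BSD(·, 2)` on the whole family, no rank input -/

/-- **THE KRIZ–LI ROAD FOR A NON-CM BASE OF SMALL CONDUCTOR — `BSD(W', 2)` at every global minimal `W' ≅ V^{(d)}` or `≅ V^{(d·d_K)}`,
`d ∈ 𝒩(V, K)`, `χ_d(−N) = 1`.** Hypotheses, exactly Kriz–Li's: `V(ℚ)[2] = 0` (`h2`), `K` imaginary quadratic with the Heegner hypothesis
for `N(V)`, a parametrisation datum `Dt`, Heegner datum, embedding, Heegner point `P ∈ V(K)` and `j : K → ℚ₂` with Assumption (★), `c₂(V)`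
odd and `Dt.c` odd if `V` is additive at `2` (`hloc`); plus the conductor bounds `N(V) < 5000` and `N(W₀) < 5000` for SOME global minimal
`W₀ ≅ V^{(d_K)}` feeding Creutz–Miller on the pair (§2). Inputs BY NAME: Kriz–Li Thm 5.1 (2) (`hKL`), Thm 4.3 (`h33`), Creutz–Miller (`hS31`).
No rank input, no CM, no GZK. BSD is not proved by any of this.
[cite: KrizLi2019, Thm. 5.1 (2) (FMS, VoR p. 30) = arXiv:1606.03172 Thm. 1.12; Thm. 4.3; Rem. 5.2] [cite: CreutzMiller2012, Thm. 1.1] [cite: Miller2011LMS, Def. 1.1] -/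
theorem krizLi_bsdp_two_of_twist_of_conductor_lt (hKL : KrizLi2019.thm112_bsdTwo_twist) (h33 : KrizLi2019.thm33_rank_twist)
    (hS31 : bsdTriple_of_analyticRank_le_one_of_conductor_lt) (hN : V.conductorNorm ℤ < 5000)
    (h2 : ∀ Q : V.toAffine.Point, 2 • Q = 0 → Q = 0)
    (K : Type) [Field K] [NumberField K] (hK : IsImaginaryQuadratic K) (hH : SatisfiesHeegnerHypothesis (V.conductorNorm ℤ) K)
    (Dt : ModularParametrizationData V (V.conductorNorm ℤ)) (H : HeegnerDatum (V.conductorNorm ℤ) (NumberField.discr K))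
    (ι : K →+* ℂ) (P : (V.baseChange K).toAffine.Point) (hP : WeierstrassCurve.Affine.Point.map ι.toRatAlgHom P = heegnerPointComplex Dt H)
    (j : K →ₐ[ℚ] ℚ_[2]) (hstar : KrizLi2019.AssumptionStar V Dt K P j)
    (hloc : (haveI : Fact (2 : ℕ).Prime := ⟨Nat.prime_two⟩;
      Odd ((V.baseChange ℚ_[2]).localTamagawaNumber ℤ_[2]) ∧
        (¬ V.HasGoodReductionAtPrime 2 → ¬ V.HasMultiplicativeReductionAtPrime 2 → Odd Dt.c)))
    (W₀ : WeierstrassCurve ℚ) [W₀.IsElliptic] [W₀.IsGloballyMinimal]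
    (hW₀ : ∃ C : VariableChange ℚ, C • V.quadraticTwist (NumberField.discr K : ℚ) = W₀) (hN₀ : W₀.conductorNorm ℤ < 5000)
    {d : ℤ} (hd : KrizLi2019.InN V K d) (hsign : Int.sign d * jacobiSym (V.conductorNorm ℤ) d.natAbs = 1)
    (W' : WeierstrassCurve ℚ) [W'.IsElliptic] [W'.IsGloballyMinimal]
    (hW' : (∃ C : VariableChange ℚ, C • V.quadraticTwist (d : ℚ) = W') ∨
      (∃ C : VariableChange ℚ, C • V.quadraticTwist ((d * NumberField.discr K : ℤ) : ℚ) = W')) :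
    BSDp W' 2 := by
  have hD : (NumberField.discr K : ℚ) ≠ 0 := by exact_mod_cast NumberField.discr_ne_zero K
  have hbase : BSDp V 2 := krizLi_bsdp_two_base_of_conductor_lt V h33 hS31 hN h2 K hK hH Dt H ι P hP j hstar
  have hbase₀ : BSDp W₀ 2 := krizLi_bsdp_two_partner_of_conductor_lt V h33 hS31 h2 K hK hH Dt H ι P hP j hstar W₀ hW₀ hN₀
  have hd0 : (d : ℚ) ≠ 0 := cast_ne_zero_of_inN V hd
  have hdK : ((d * NumberField.discr K : ℤ) : ℚ) ≠ 0 := by push_cast; exact mul_ne_zero hd0 hD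
  rcases hW' with hW' | hW'
  · obtain ⟨W₂, _, _, hW₂⟩ := exists_globallyMinimal_twist V hdK
    exact (bsdp_two_twists_of_krizLi hKL h2 K hK hH Dt H ι P hP j hstar hloc hW₀ hbase hbase₀ d hd hsign
      (W₁ := W') (W₂ := W₂) hW' hW₂).1
  · obtain ⟨W₁, _, _, hW₁⟩ := exists_globallyMinimal_twist V hd0
    exact (bsdp_two_twists_of_krizLi hKL h2 K hK hH Dt H ι P hP j hstar hloc hW₀ hbase hbase₀ d hd hsign
      (W₁ := W₁) (W₂ := W') hW₁ hW').2

/-! ## §4 The K4-keyed sorting: the rank-zero members (C3″ / C1″ at `2`) and the rank-one companions -/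

/-- **THE KRIZ–LI PRINT ROAD, K4-keyed — the RANK-ZERO members `V^{(d)}`.** For a NON-CM global minimal base `V` of conductor `< 5000`,
ADDITIVE and POTENTIALLY GOOD at `2`, with `V[2]` IRREDUCIBLE (so `V(ℚ)[2] = 0`) and `r_an(V) = 0` (displayed: Cremona's `r = 0` / the
caption «rank zero curves» of Kriz–Li's Table 2), a Heegner field `K`, the (★)-datum and `hloc` as in §3, and
`N(W₀) < 5000` at some global minimal `W₀ ≅ V^{(d_K)}`: at EVERY global minimal `W₁ ≅ V^{(d)}`, `d ∈ 𝒩(V, K)`, `χ_d(−N) = 1`: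
`r_an(W₁) = 0 ∧ Addv W₁ 2 ∧ 0 ≤ ord₂ j(W₁) ∧ ¬CM ∧ Irr W₁ 2 ∧ BSD(W₁, 2) ∧ MissingLowerBoundAt W₁ 2 ∧ MissingUpperBoundAt W₁ 2` —
BOTH K4 halves on an `E[2]`-IRREDUCIBLE additive family (the Zhai road gives the lower half only). Inputs BY NAME: Kriz–Li Thm 5.1 (2)
(`hKL`), Thm 4.3 (`h33`), Creutz–Miller (`hS31`), Gross–Zagier–Kolyvagin (`hGZK`, finiteness of `Ш(W₁)` for the halves bookkeeping).
BSD is not proved by any of this. [cite: KrizLi2019, Thm. 5.1 (2) and Thm. 4.3; §6 Example 6.5, Table 2] [cite: CreutzMiller2012, Thm. 1.1]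
[cite: Miller2011LMS, Def. 1.1] [cite: SilvermanAEC2009, VII.5 and X.5] -/
theorem printFamilyKrizLi_rankZero (hKL : KrizLi2019.thm112_bsdTwo_twist) (h33 : KrizLi2019.thm33_rank_twist)
    (hS31 : bsdTriple_of_analyticRank_le_one_of_conductor_lt) (hGZK : rank_eq_analyticRank_of_analyticRank_le_one)
    (hN : V.conductorNorm ℤ < 5000) (hr : V.analyticRank = 0)
    (hadd : haveI : Fact (Nat.Prime 2) := ⟨Nat.prime_two⟩; Addv V 2) (hj : 0 ≤ padicValRat 2 V.j) (hcm : ¬ V.HasCM)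
    (hirr : haveI : Fact (Nat.Prime 2) := ⟨Nat.prime_two⟩; Irr V 2)
    (K : Type) [Field K] [NumberField K] (hK : IsImaginaryQuadratic K)
    (hH : SatisfiesHeegnerHypothesis (V.conductorNorm ℤ) K)
    (Dt : ModularParametrizationData V (V.conductorNorm ℤ)) (H : HeegnerDatum (V.conductorNorm ℤ) (NumberField.discr K))
    (ι : K →+* ℂ) (P : (V.baseChange K).toAffine.Point) (hP : WeierstrassCurve.Affine.Point.map ι.toRatAlgHom P = heegnerPointComplex Dt H)
    (j : K →ₐ[ℚ] ℚ_[2]) (hstar : KrizLi2019.AssumptionStar V Dt K P j)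
    (hloc : (haveI : Fact (2 : ℕ).Prime := ⟨Nat.prime_two⟩;
      Odd ((V.baseChange ℚ_[2]).localTamagawaNumber ℤ_[2]) ∧
        (¬ V.HasGoodReductionAtPrime 2 → ¬ V.HasMultiplicativeReductionAtPrime 2 → Odd Dt.c)))
    (W₀ : WeierstrassCurve ℚ) [W₀.IsElliptic] [W₀.IsGloballyMinimal]
    (hW₀ : ∃ C : VariableChange ℚ, C • V.quadraticTwist (NumberField.discr K : ℚ) = W₀) (hN₀ : W₀.conductorNorm ℤ < 5000)
    {d : ℤ} (hd : KrizLi2019.InN V K d) (hsign : Int.sign d * jacobiSym (V.conductorNorm ℤ) d.natAbs = 1)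
    (W₁ : WeierstrassCurve ℚ) [W₁.IsElliptic] [W₁.IsGloballyMinimal]
    (hW₁ : ∃ C : VariableChange ℚ, C • V.quadraticTwist (d : ℚ) = W₁) :
    haveI : Fact (Nat.Prime 2) := ⟨Nat.prime_two⟩
    W₁.analyticRank = 0 ∧ Addv W₁ 2 ∧ 0 ≤ padicValRat 2 W₁.j ∧ ¬ W₁.HasCM ∧ Irr W₁ 2 ∧
      BSDp W₁ 2 ∧ MissingLowerBoundAt W₁ 2 ∧ MissingUpperBoundAt W₁ 2 := by
  haveI : Fact (Nat.Prime 2) := ⟨Nat.prime_two⟩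
  have h2 : ∀ Q : V.toAffine.Point, 2 • Q = 0 → Q = 0 := (X5.O1.irr_two_iff_forall_two_nsmul V).mp hirr
  have hD : (NumberField.discr K : ℚ) ≠ 0 := by exact_mod_cast NumberField.discr_ne_zero K
  have hd0 : (d : ℚ) ≠ 0 := cast_ne_zero_of_inN V hd
  have hdK : ((d * NumberField.discr K : ℤ) : ℚ) ≠ 0 := by push_cast; exact mul_ne_zero hd0 hD
  -- `BSD(W₁, 2)` by §3
  have hB : BSDp W₁ 2 := krizLi_bsdp_two_of_twist_of_conductor_lt V hKL h33 hS31 hN h2 K hK hH Dt H ι P hP j hstar hloc W₀ hW₀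
    hN₀ hd hsign W₁ (Or.inl hW₁)
  -- `r_an(W₁) = r_an(V) = 0` by Thm 4.3 at `d`
  obtain ⟨W₂, _, _, hW₂⟩ := exists_globallyMinimal_twist V hdK
  obtain ⟨-, heq⟩ := krizLi_analyticRank_twists V h33 h2 K hK hH Dt H ι P hP j hstar hd hsign W₁ W₂ hW₁ hW₂
  have hr1 : W₁.analyticRank = 0 := by rw [heq, hr]
  -- the halves (`Ш(W₁)` finite by GZK in analytic rank `0`)
  haveI : Finite W₁.sha := (hGZK W₁ (by rw [hr1]; norm_num)).2
  have hLU := lower_and_upper_of_missingPPartAt W₁ 2 (missingPPartAt_of_bsdp W₁ 2 hB)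
  -- the habitat along the unramified twist `d ≡ 1 (mod 4)`
  obtain ⟨hA, hJ, hcmW, hirrW⟩ := habitat_twist_of_addv V hadd hj hcm hirr hd.1 (by exact_mod_cast Int.natAbs_ne_zero.mp hd.2.1.ne_zero)
    W₁ hW₁
  exact ⟨hr1, hA, hJ, hcmW, hirrW, hB, hLU.1, hLU.2⟩

/-- **THE RANK-ONE COMPANIONS `V^{(d·d_K)}`** (same data, `d_K ≡ 1 (mod 4)`): at every global minimal `W₂ ≅ V^{(d·d_K)}`: `r_an(W₂) = 1`, `W₂` ADDITIVE and
POTENTIALLY GOOD at `2` (`d·d_K ≡ 1 (mod 4)`: same type at `2`), NON-CM, `W₂[2]` IRREDUCIBLE, and `BSD(W₂, 2)` — a print-decided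
RANK-ONE `E[2]`-irreducible additive family (bears on K4's `RankOneAtTwo` children; recorded, not this seat's item). Inputs as above
(no GZK). BSD is not proved by any of this. [cite: KrizLi2019, Thm. 5.1 (2) and Thm. 4.3] [cite: CreutzMiller2012, Thm. 1.1] [cite: Miller2011LMS, Def. 1.1] -/
theorem printFamilyKrizLi_rankOne (hKL : KrizLi2019.thm112_bsdTwo_twist) (h33 : KrizLi2019.thm33_rank_twist)
    (hS31 : bsdTriple_of_analyticRank_le_one_of_conductor_lt)
    (hN : V.conductorNorm ℤ < 5000) (hr : V.analyticRank = 0)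
    (hadd : haveI : Fact (Nat.Prime 2) := ⟨Nat.prime_two⟩; Addv V 2) (hj : 0 ≤ padicValRat 2 V.j) (hcm : ¬ V.HasCM)
    (hirr : haveI : Fact (Nat.Prime 2) := ⟨Nat.prime_two⟩; Irr V 2)
    (K : Type) [Field K] [NumberField K] (hK : IsImaginaryQuadratic K) (hK4 : NumberField.discr K % 4 = 1)
    (hH : SatisfiesHeegnerHypothesis (V.conductorNorm ℤ) K)
    (Dt : ModularParametrizationData V (V.conductorNorm ℤ)) (H : HeegnerDatum (V.conductorNorm ℤ) (NumberField.discr K))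
    (ι : K →+* ℂ) (P : (V.baseChange K).toAffine.Point) (hP : WeierstrassCurve.Affine.Point.map ι.toRatAlgHom P = heegnerPointComplex Dt H)
    (j : K →ₐ[ℚ] ℚ_[2]) (hstar : KrizLi2019.AssumptionStar V Dt K P j)
    (hloc : (haveI : Fact (2 : ℕ).Prime := ⟨Nat.prime_two⟩;
      Odd ((V.baseChange ℚ_[2]).localTamagawaNumber ℤ_[2]) ∧
        (¬ V.HasGoodReductionAtPrime 2 → ¬ V.HasMultiplicativeReductionAtPrime 2 → Odd Dt.c)))
    (W₀ : WeierstrassCurve ℚ) [W₀.IsElliptic] [W₀.IsGloballyMinimal]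
    (hW₀ : ∃ C : VariableChange ℚ, C • V.quadraticTwist (NumberField.discr K : ℚ) = W₀) (hN₀ : W₀.conductorNorm ℤ < 5000)
    {d : ℤ} (hd : KrizLi2019.InN V K d) (hsign : Int.sign d * jacobiSym (V.conductorNorm ℤ) d.natAbs = 1)
    (W₂ : WeierstrassCurve ℚ) [W₂.IsElliptic] [W₂.IsGloballyMinimal]
    (hW₂ : ∃ C : VariableChange ℚ, C • V.quadraticTwist ((d * NumberField.discr K : ℤ) : ℚ) = W₂) :
    haveI : Fact (Nat.Prime 2) := ⟨Nat.prime_two⟩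
    W₂.analyticRank = 1 ∧ Addv W₂ 2 ∧ 0 ≤ padicValRat 2 W₂.j ∧ ¬ W₂.HasCM ∧ Irr W₂ 2 ∧ BSDp W₂ 2 := by
  haveI : Fact (Nat.Prime 2) := ⟨Nat.prime_two⟩
  have h2 : ∀ Q : V.toAffine.Point, 2 • Q = 0 → Q = 0 := (X5.O1.irr_two_iff_forall_two_nsmul V).mp hirr
  have hd0 : (d : ℚ) ≠ 0 := cast_ne_zero_of_inN V hd
  -- `BSD(W₂, 2)` by §3
  have hB : BSDp W₂ 2 := krizLi_bsdp_two_of_twist_of_conductor_lt V hKL h33 hS31 hN h2 K hK hH Dt H ι P hP j hstar hloc W₀ hW₀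
    hN₀ hd hsign W₂ (Or.inr hW₂)
  -- `r_an(W₂) = 1` by Thm 4.3 at `d` (`r_an(W₁) = r_an(V) = 0`)
  obtain ⟨W₁, _, _, hW₁⟩ := exists_globallyMinimal_twist V hd0
  obtain ⟨hor, heq⟩ := krizLi_analyticRank_twists V h33 h2 K hK hH Dt H ι P hP j hstar hd hsign W₁ W₂ hW₁ hW₂
  have hr2 : W₂.analyticRank = 1 := by omega
  -- the habitat along the unramified twist `d·d_K ≡ 1 (mod 4)`
  have hdd4 : (d * NumberField.discr K) % 4 = 1 := by rw [Int.mul_emod, hd.1, hK4]; decide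
  have hdd0 : d * NumberField.discr K ≠ 0 := mul_ne_zero (Int.natAbs_ne_zero.mp hd.2.1.ne_zero) (NumberField.discr_ne_zero K)
  obtain ⟨hA, hJ, hcmW, hirrW⟩ := habitat_twist_of_addv V hadd hj hcm hirr hdd4 hdd0 W₂ hW₂
  exact ⟨hr2, hA, hJ, hcmW, hirrW, hB⟩

end Base

end Summit.BirchSwinnertonDyer.BirchSwinnertonDyer.Theorems.AddPotGoodPrint

end
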